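import Mathlib
import Literature.Computability.Complexity.CircuitDAG
import Summits.PneNP.PneNP.Theorems.SymmetryBudgetHamCompilesIface
import Summits.PneNP.PneNP.Theorems.SymmetryBudgetHamCompilesRankGadgetSymm

/-!
# The F-side gate DAG of the line `kotzig-cutspan` (crux `SymmetryBudget.HamCompiles`,
# stmt-PneNP-10637) — definitions (lead prover, stub `stub_symmetricF`)

The Bud-symmetric threshold circuits computing the F-interface `fData m x` (reduced echelon tables
of the closed states `Cspan m x F d` of the span recursion) are compiled from ONE labelled DAG on the
gate type `FΛ m = SymA.RΛ m ⊕ FG m` (the rank gadget of `…RankGadget.lean` plus the gates below),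
all of whose indices are vertices `u : Fin m`, subsets `P ⊆ F` of the free part (`PSet m`, `2^g = m`
of them), ranks, margin CODE WORDS `e : Fin 3g → Bool` (decoded by `dOf`), cut coordinates
`c : Fin g → Bool` (enumerated by `kc : Fin 2^g ≃ _`) and small counters — so that a budget
permutation `ρ` acts on gate labels by relabelling every vertex index.

Organisation of the gates (`FG`): every SUBSPACE of the recursion is carried as its reduced echelon
TABLE (`2^g × 2^g` wires). Tables are combined by CHAINS of `N = 2^g` INSERTION BLOCKS (`BK`: reduce
the incoming row by the current table with a sequential chain of `XOR₂`s, locate its leading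
coordinate, update every row — the Boolean form of `insertRow`), and orbit-indexed sums
`⨆_{w ∈ B} T_w` by the SUBSET TOWER `U_B = ⋁_{w ∈ B} chain(U_{B∖w}, rows of T_w)` (all copies are
equal, so the `∨` is symmetric and exact). States: open `(P, t, i, e)` (tower over `w ∈ P∖t`, base
`[rk t = i]·C(P∖t, e)`), closed `(P, e)` (tower over `t ∈ P` of the inner accumulations over the `g²`
rank pairs `(i, j)` of `[rk t = j ∧ δᵢ+δⱼ ≤ e]·mask_{ij} O(P, t, i, e−δᵢ−δⱼ)`), `C(∅, e)` hard-wired.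
This file: parameters (§1), gate labels / gate functions / wiring (§2). Part 2
(`SymmetryBudgetHamCompilesFDagSem.lean`): the intended semantics `fsem` of every gate (§3), the
relabelling action `fmapB` (§4), the acyclicity measure `fμ` (§5), and the proof obligations (§6)
that the line's registered stubs `stub_symmetricF_wires/blocks/struct/aut/out` discharge; the lead
assembles `stub_symmetricF` from them.
-/

-- `Summit.PneNP.PneNP.…` duplicates `PneNP` BY DESIGN (single-problem summit, D-0017).
set_option linter.dupNamespace false

noncomputable section

namespace Summit.PneNP.PneNP.Theorems.HamCompilesKC

open Literature.Computability.Complexity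
open Finset

namespace SymF

variable {m : ℕ}

/-! ### §1 Parameters: coordinates, subsets of the free part, margin codes -/

/-- Number of cut coordinates `N = 2^g`. -/
abbrev N (m : ℕ) : ℕ := 2 ^ gOf m

/-- Cut coordinates. -/
abbrev K (m : ℕ) : Type := Fin (gOf m) → Bool

/-- Margin code words. -/
abbrev Cd (m : ℕ) : Type := Fin (3 * gOf m) → Bool

/-- Subsets of the free part (the DP's vertex sets; `2^g ≤ m` of them). -/
abbrev PSet (m : ℕ) : Type := {P : Finset (Fin m) // P ⊆ freeSet m}

/-- `N ≥ 1`. -/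
theorem N_pos (m : ℕ) : 0 < N m := Nat.two_pow_pos _

/-- The `k`-th cut coordinate (a fixed enumeration, untouched by vertex permutations). -/
def kc (k : Fin (N m)) : K m := (boolVecEquiv (gOf m)).symm k

/-- The `skey`-least coordinate (the empty indicator). -/
def cmin : K m := fun _ => false

open scoped Classical in
/-- The margin vector coded by `e` (of total mass `≤ 2g`; `0` if `e` is not a code word). -/
def dOf (e : Cd m) : Fin (gOf m) → ℕ :=
  if h : ∃ d : Fin (gOf m) → ℕ, (∑ t, d t) ≤ 2 * gOf m ∧ sbCode d = e then Classical.choose h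
  else 0

/-- `e` is a code word. -/
def Valid (e : Cd m) : Prop := ∃ d : Fin (gOf m) → ℕ, (∑ t, d t) ≤ 2 * gOf m ∧ sbCode d = e

/-- The code of the predecessor margins `dOf e − δᵢ − δⱼ`. -/
def cminus (e : Cd m) (i j : Fin (gOf m)) : Cd m := sbCode (dOf e - δ i - δ j)

/-- The margin guard `δᵢ + δⱼ ≤ dOf e`. -/
def MGuard (e : Cd m) (i j : Fin (gOf m)) : Prop := δ i + δ j ≤ dOf e

/-- Erasing a vertex keeps a subset inside the free part. -/
def PSet.erase (P : PSet m) (t : Fin m) : PSet m :=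
  ⟨P.1.erase t, (Finset.erase_subset _ _).trans P.2⟩

/-- The whole free part. -/
def PSet.top (m : ℕ) : PSet m := ⟨freeSet m, Finset.Subset.refl _⟩

/-- The `r`-th rank pair `(i, j)` of the inner accumulation (a fixed enumeration). -/
def pr (r : Fin (gOf m * gOf m)) : Fin (gOf m) × Fin (gOf m) := finProdFinEquiv.symm r

/-! ### §2 Gate labels, gate functions, wiring -/

/-- Tower contexts: the open state `(P, t, i, e)` (tower over `w ∈ P∖t`) and the closed state
`(P, e)` (tower over `t ∈ P`). -/
inductive TCtx (m : ℕ) : Type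
  | ot (P : PSet m) (t : Fin m) (i : Fin (gOf m)) (e : Cd m)
  | ct (P : PSet m) (e : Cd m)
  deriving DecidableEq

/-- Chain contexts: the tower chain `chain(U_{B∖w}, rows of the term of w)` of tower `τ` at node
`B`, and the `r`-th inner accumulation chain of the closed state `(P, e)` at vertex `t`. -/
inductive ChCtx (m : ℕ) : Type
  | tw (τ : TCtx m) (B : PSet m) (w : Fin m)
  | inner (P : PSet m) (e : Cd m) (t : Fin m) (r : Fin (gOf m * gOf m))
  deriving DecidableEq

/-- Gate kinds of ONE insertion block (stage `s`, row `c`, column `c'`, lead candidate `ℓ`):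
`ya` = `y_{c_s} ∧ T[c_s][c']`; `xo, xa, xn, xr` = the `XOR₂` adding it to the running remainder;
`nz` = `¬z`; `ld` = "`c` is the leading coordinate of the remainder"; `al, q` = "`T[c]` has a `1`
in the leading column"; `nl = ¬ld`; `t1, wq, uo, ua, un, ux, t2, out` = the new row bit
`(ld c ∧ z c') ∨ (¬ld c ∧ (T[c][c'] ⊕ (z c' ∧ q c)))`. -/
inductive BK (m : ℕ) : Type
  | ya (s : Fin (N m)) (c' : K m)
  | xo (s : Fin (N m)) (c' : K m)
  | xa (s : Fin (N m)) (c' : K m)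
  | xn (s : Fin (N m)) (c' : K m)
  | xr (s : Fin (N m)) (c' : K m)
  | nz (c : K m)
  | ld (c : K m)
  | al (c ℓ : K m)
  | q (c : K m)
  | nl (c : K m)
  | t1 (c c' : K m)
  | wq (c c' : K m)
  | uo (c c' : K m)
  | ua (c c' : K m)
  | un (c c' : K m)
  | ux (c c' : K m)
  | t2 (c c' : K m)
  | out (c c' : K m)
  deriving DecidableEq

/-- Gate labels of the F-side proper: constants, the hard-wired table of `C(∅, e)`, the base of an
open tower (`ob`), tower nodes (`tw`), guarded row sources (`rowO`, `rowI`), block gates (`blk`). -/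
inductive FG (m : ℕ) : Type
  | zero : FG m
  | one : FG m
  | unitC (e : Cd m) (c c' : K m) : FG m
  | ob (P : PSet m) (t : Fin m) (i : Fin (gOf m)) (e : Cd m) (c c' : K m) : FG m
  | tw (τ : TCtx m) (B : PSet m) (c c' : K m) : FG m
  | rowO (P : PSet m) (t : Fin m) (i : Fin (gOf m)) (e : Cd m) (w : Fin m) (k : Fin (N m))
      (c' : K m) : FG m
  | rowI (P : PSet m) (e : Cd m) (t : Fin m) (r : Fin (gOf m * gOf m)) (k : Fin (N m))
      (c' : K m) : FG m
  | blk (χ : ChCtx m) (k : Fin (N m)) (κ : BK m) : FG m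
  deriving DecidableEq

set_option synthInstance.maxHeartbeats 400000 in
set_option synthInstance.maxSize 2048 in
/-- Finitely many tower contexts. -/
instance instFintypeTCtx (m : ℕ) : Fintype (TCtx m) := Fintype.ofEquiv _ (proxy_equiv% (TCtx m))
/-- Finitely many chain contexts. -/
instance instFintypeChCtx (m : ℕ) : Fintype (ChCtx m) :=
  Fintype.ofEquiv _ (proxy_equiv% (ChCtx m))
set_option synthInstance.maxHeartbeats 400000 in
set_option synthInstance.maxSize 4096 in
/-- Finitely many block gate kinds. -/
instance instFintypeBK (m : ℕ) : Fintype (BK m) := Fintype.ofEquiv _ (proxy_equiv% (BK m))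
set_option synthInstance.maxHeartbeats 400000 in
set_option synthInstance.maxSize 4096 in
/-- Finitely many F-side gate labels. -/
instance instFintypeFG (m : ℕ) : Fintype (FG m) := Fintype.ofEquiv _ (proxy_equiv% (FG m))

/-- All gate labels: the rank gadget and the F-side proper. -/
abbrev FΛ (m : ℕ) : Type := SymA.RΛ m ⊕ FG m

/-- Wires: matrix inputs or gates. -/
abbrev FW (m : ℕ) : Type := (Fin m × Fin m) ⊕ FΛ m

/-- Wire of a gadget gate. -/
def gW (l : SymA.RΛ m) : FW m := Sum.inr (Sum.inl l)

/-- Wire of an F-side gate. -/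
def fW (f : FG m) : FW m := Sum.inr (Sum.inr f)

/-- The constant-false wire. -/
def zeroW : FW m := fW .zero

/-- The constant-true wire. -/
def oneW : FW m := fW .one

/-- `[rk t = i]` (gadget). -/
def eqrankW (i : Fin (gOf m)) (t : Fin m) : FW m := gW (.eqrank i t)

/-- `[w ∼ t]` for distinct free `w, t` (gadget edge gate `x(w,t) ∨ x(t,w)`). -/
def adjW (w t : Fin m) : FW m := gW (.e w t)

/-- The last block of a chain. -/
def kLast (m : ℕ) : Fin (N m) := ⟨N m - 1, Nat.sub_lt (N_pos m) Nat.one_pos⟩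

/-- The table wire `U_B[c][c']` of tower `τ` at node `B` (`U_∅` = the base: `ob` for an open tower,
zero for a closed one). -/
def uW : TCtx m → PSet m → K m → K m → FW m
  | .ot P t i e, B, c, c' => if B.1 = ∅ then fW (.ob P t i e c c') else fW (.tw (.ot P t i e) B c c')
  | .ct P e, B, c, c' => if B.1 = ∅ then zeroW else fW (.tw (.ct P e) B c c')

/-- The table wire of the open state `O(P, t, i, e)` (zero unless `t ∈ P`). -/
def oTab (P : PSet m) (t : Fin m) (i : Fin (gOf m)) (e : Cd m) (c c' : K m) : FW m :=
  if t ∈ P.1 then uW (.ot P t i e) (P.erase t) c c' else zeroW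

/-- The table wire of the closed state `C(P, e)` (`C(∅, e)` hard-wired). -/
def cTab (P : PSet m) (e : Cd m) (c c' : K m) : FW m :=
  if P.1 = ∅ then fW (.unitC e c c') else uW (.ct P e) P c c'

/-- The output table of a chain: the `out` gates of its last block. -/
def chOut (χ : ChCtx m) (c c' : K m) : FW m := fW (.blk χ (kLast m) (.out c c'))

/-- The accumulator `Acc_r` of the inner accumulation at `(P, e, t)` (`Acc_0 = 0`). -/
def accW (P : PSet m) (e : Cd m) (t : Fin m) (r : ℕ) (c c' : K m) : FW m :=
  if r = 0 then zeroW else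
    if h : r - 1 < gOf m * gOf m then chOut (.inner P e t ⟨r - 1, h⟩) c c' else zeroW

/-- The inner table `Inner(P, e, t) = Acc_{g²}`. -/
def innerTab (P : PSet m) (e : Cd m) (t : Fin m) (c c' : K m) : FW m :=
  accW P e t (gOf m * gOf m) c c'

/-- The LEFT table of a chain (what the rows are inserted into). -/
def leftW : ChCtx m → K m → K m → FW m
  | .tw τ B w, c, c' => if w ∈ B.1 then uW τ (B.erase w) c c' else zeroW
  | .inner P e t r, c, c' => accW P e t r c c'

/-- The table `T_k` read by block `k` of chain `χ` (`T_0` = the left table). -/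
def tabW (χ : ChCtx m) (k : Fin (N m)) (c c' : K m) : FW m :=
  if (k : ℕ) = 0 then leftW χ c c'
  else fW (.blk χ ⟨(k : ℕ) - 1, lt_of_le_of_lt (Nat.sub_le _ _) k.2⟩ (.out c c'))

open scoped Classical in
/-- The ROW SOURCE: bit `c'` of the `k`-th vector inserted by chain `χ` (guards and masks applied:
a masked-out or guarded-out bit is the zero wire). -/
def rowW : ChCtx m → Fin (N m) → K m → FW m
  | .tw (.ot P t i e) _ w, k, c' => fW (.rowO P t i e w k c')
  | .tw (.ct P e) _ t, k, c' => innerTab P e t (kc k) c'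
  | .inner P e t r, k, c' =>
      if c' (pr r).1 = c' (pr r).2 ∧ MGuard e (pr r).1 (pr r).2 then fW (.rowI P e t r k c')
      else zeroW

/-- The running remainder `z^{(s)}[c']` of block `(χ, k)` (`z^{(0)} = y`). -/
def zW (χ : ChCtx m) (k : Fin (N m)) (s : ℕ) (c' : K m) : FW m :=
  if s = 0 then rowW χ k c'
  else if h : s - 1 < N m then fW (.blk χ k (.xr ⟨s - 1, h⟩ c')) else zeroW

/-- The final remainder `z = z^{(N)}`. -/
def zfW (χ : ChCtx m) (k : Fin (N m)) (c' : K m) : FW m := zW χ k (N m) c'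

/-- Gate functions of the block gates. -/
def bfn (m : ℕ) : BK m → GateFn
  | .ya _ _ => GateFn.and 2
  | .xo _ _ => GateFn.or 2
  | .xa _ _ => GateFn.and 2
  | .xn _ _ => GateFn.not
  | .xr _ _ => GateFn.and 2
  | .nz _ => GateFn.not
  | .ld _ => GateFn.and (N m + 1)
  | .al _ _ => GateFn.and 2
  | .q _ => GateFn.or (N m)
  | .nl _ => GateFn.not
  | .t1 _ _ => GateFn.and 2
  | .wq _ _ => GateFn.and 2
  | .uo _ _ => GateFn.or 2
  | .ua _ _ => GateFn.and 2
  | .un _ _ => GateFn.not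
  | .ux _ _ => GateFn.and 2
  | .t2 _ _ => GateFn.and 2
  | .out _ _ => GateFn.or 2

/-- Wiring of the block gates of block `(χ, k)`. -/
def bargs (χ : ChCtx m) (k : Fin (N m)) : (κ : BK m) → Fin (bfn m κ).1 → FW m
  | .ya s c' => ![rowW χ k (kc s), tabW χ k (kc s) c']
  | .xo s c' => ![zW χ k s c', fW (.blk χ k (.ya s c'))]
  | .xa s c' => ![zW χ k s c', fW (.blk χ k (.ya s c'))]
  | .xn s c' => ![fW (.blk χ k (.xa s c'))]
  | .xr s c' => ![fW (.blk χ k (.xo s c')), fW (.blk χ k (.xn s c'))]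
  | .nz c => ![zfW χ k c]
  | .ld c => Fin.cases (zfW χ k c)
      (fun s : Fin (N m) => if skey (kc s) < skey c then fW (.blk χ k (.nz (kc s))) else oneW)
  | .al c ℓ => ![fW (.blk χ k (.ld ℓ)), tabW χ k c ℓ]
  | .q c => fun s : Fin (N m) => fW (.blk χ k (.al c (kc s)))
  | .nl c => ![fW (.blk χ k (.ld c))]
  | .t1 c c' => ![fW (.blk χ k (.ld c)), zfW χ k c']
  | .wq c c' => ![zfW χ k c', fW (.blk χ k (.q c))]
  | .uo c c' => ![tabW χ k c c', fW (.blk χ k (.wq c c'))]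
  | .ua c c' => ![tabW χ k c c', fW (.blk χ k (.wq c c'))]
  | .un c c' => ![fW (.blk χ k (.ua c c'))]
  | .ux c c' => ![fW (.blk χ k (.uo c c')), fW (.blk χ k (.un c c'))]
  | .t2 c c' => ![fW (.blk χ k (.nl c)), fW (.blk χ k (.ux c c'))]
  | .out c c' => ![fW (.blk χ k (.t1 c c')), fW (.blk χ k (.t2 c c'))]

open scoped Classical in
/-- Gate functions of the F-side gates. -/
def gfn (m : ℕ) : FG m → GateFn
  | .zero => GateFn.or 0
  | .one => GateFn.and 0
  | .unitC e c _ => GateFn.const (decide (dOf e = 0) && decide (c = cmin))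
  | .ob _ _ _ _ _ _ => GateFn.and 2
  | .tw _ _ _ _ => GateFn.or m
  | .rowO _ _ _ _ _ _ _ => GateFn.and 2
  | .rowI _ _ _ _ _ _ => GateFn.and 2
  | .blk _ _ κ => bfn m κ

/-- Wiring of the F-side gates. -/
def gargs : (f : FG m) → Fin (gfn m f).1 → FW m
  | .zero => Fin.elim0
  | .one => Fin.elim0
  | .unitC _ _ _ => Fin.elim0
  | .ob P t i e c c' => ![eqrankW i t, if t ∈ P.1 then cTab (P.erase t) e c c' else zeroW]
  | .tw τ B c c' => fun w : Fin m => if w ∈ B.1 then chOut (.tw τ B w) c c' else zeroW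
  | .rowO P t i e w k c' =>
      ![adjW w t, if t ∈ P.1 then oTab (P.erase t) w i e (kc k) c' else zeroW]
  | .rowI P e t r k c' =>
      ![eqrankW (pr r).2 t, oTab P t (pr r).1 (cminus e (pr r).1 (pr r).2) (kc k) c']
  | .blk χ k κ => bargs χ k κ

/-- Gate functions of the whole DAG. -/
def ffn (m : ℕ) : FΛ m → GateFn
  | .inl l => SymA.rfn l
  | .inr f => gfn m f

/-- Wiring of the whole DAG (gadget wires embedded along `Sum.inl`). -/
def fargs : (l : FΛ m) → Fin (ffn m l).1 → FW m
  | .inl l => fun a => (SymA.rargs l a).map id Sum.inl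
  | .inr f => gargs f

/-- The output wire of the F-interface index `(e, S, S')`: the table of `C(F, dOf e)` at a code
word, zero otherwise. -/
def fout (m : ℕ) (i : FIdx m) : FW m :=
  by classical exact if Valid i.1 then cTab (PSet.top m) i.1 i.2.1 i.2.2 else zeroW

end SymF

end Summit.PneNP.PneNP.Theorems.HamCompilesKC
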